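import Summits.HodgeConjecture.HodgeConjecture.Theorems.F0P3cStCharTSShellOrbitalG    -- ★ p849606 LH2-p03 (g3) D3-ii-G: carriers, `measureReal_cmBorelM_inter_level_pos` (N = 3), the G-side closed-form constant
import Summits.HodgeConjecture.HodgeConjecture.Theorems.F0P3cStCharTSShellOrbitalH    -- ★ p849562 LH7-p04 (g2) D3-ii-H: the H-side closed-form constant (`μ_T{K_{2,v}}·ν₁(univ) ∕ (μ_T(C₂)·ν₁(K₁))`)
import Literature.NumberTheory.Automorphic.CompactOpenAveraging                       -- ★ `IsLeftTransversal`, `IsLeftTransversal.nonempty`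
import HarnessLib

/-!
# F0 · P3c · line LH6 «StCharTS» — road (D) «DEEP-FL», brick ⑦ «CONSTANTS»: the closed-form constants `κ_G`, `κ_{H,j}` of the two-coset ∕ coset-sum step functions are
# NON-ZERO, and the per-coset choice `c_j := τ_j · (κ_G κ) ∕ κ_{H,j}` satisfies the `hval` slot of the (D-c) checklist

Cell `pub/hodgecm-mathlib`, crux H413 = `stmt-HodgeConjecture-24833` (lane `--supports … --as helper`), route HCCMUnconditional; seat F0P2-p06 (g15), dealt by the road-(D) owner
LH6-p04 (g3) 2026-09-02T06:52:31Z (⑦ «CONSTANTS★»; board `F0/P3b/LH6-p04/g3/ROAD-D.status.v7.txt` 7d68ee6667d2d4d5).  THEOREMS ONLY, sorry-free, ★-only imports; no definition ∕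
instance ∕ notation ∕ named fact.  HONEST LABEL: count-neutral plumbing of road (D) — nothing here closes (S-X) `stub_StXIGSt`; HC_CM is proved only modulo the 7 printed citations
(2 remaining: hLiu418 = stmt-HodgeConjecture-24832, h413 = stmt-HodgeConjecture-24833) until rung 0 closes.

THE MATHEMATICS ([Rogawski1990, §4.9 (4.9.4) p. 56; §12.7 Lemma 12.7.3 (proof) p. 195]).  In the checklist ★ p849876
`F0P3cStCharTSTransferChecklist.isLocalDeltaTransfer_doubleCosetSum_of_checklist` (over ★ KIT-B `F0P3cStCharTSHleviCosets.hc_of_cosetSum`) the `G`-side step function is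
`Φ_G = κ_G · (𝟙_{B₁} + κ 𝟙_{B₂})` and the `H`-side one is `Σ_j c_j · κ_{H,j} · (𝟙_{C_j} + κ′_j 𝟙_{C′_j})`; the slot `hval : ∀ j ∈ s, c_j · κ_{H,j} = τ_j · (κ_G κ)` is met by
the CHOICE `c_j := τ_j · (κ_G κ) ∕ κ_{H,j}` as soon as `κ_{H,j} ≠ 0` (§1 `hval_of_div`, `hval_of_div'`).  The constants are products of: the Haar mass of a compact open subgroup
(`K_n`, `K_{2,n′}`, `K₁`, `T ∩ K_v`, `C`), the cardinality of a finite left transversal (non-empty: ★ `IsLeftTransversal.nonempty`), a value of the unit-valued character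
`rootDeltaChar` ∕ `χ₁`, and — on `H` — the total mass `ν₁(U(Φ₁)_v)` of the COMPACT group `U(Φ₁)_v`; each factor is a non-zero complex number (§1, generic: open + compact +
non-empty ⇒ `0 < μ.real`, for any measure positive on opens and finite on compacts, e.g. a Haar measure), hence so are `κ_G` (§2, the constant of ★ D3-ii-G
`classOrbitalIntegral_mk_eq_twoCoset` with `A :=` the F1-G ∕ HF1-SHELL constant `ν(K_n)·#R·δ_B^{1∕2}(b)` at the measure `ν_G ∘ e⁻¹`) and `κ_{H,j}` (§3, the constant of ★ D3-ii-H
`classOrbitalIntegralH_eq_twoCoset_apply` with `A :=` the F1-H ∕ hF1H-ADAPTER constant `ν₂(K_{2,n′})·#R₂·ν₁(K₁)·δ_{B₂}^{1∕2}(u)` times `χ₁(z₁)`).  The statements spell the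
constants TOKEN FOR TOKEN as those ★ files print them, so the XIG-ASSEMBLY head discharges `κ_G ≠ 0` ∕ `κ_{H,j} ≠ 0` ∕ `hval` by `exact`; the atomic factors are also exported
one by one (any other parenthesisation closes by `mul_ne_zero` ∕ `div_ne_zero` over them).

## References
* [Rogawski1990] J. D. Rogawski, *Automorphic Representations of Unitary Groups in Three Variables*, Ann. of Math. Stud. 123 (1990): §4.9 (4.9.4) p. 56; §12.7 Lemma 12.7.3
  (proof) p. 195.
* [HewittRoss1979] E. Hewitt, K. A. Ross, *Abstract Harmonic Analysis I*, 2nd ed. (1979), (15.8) (Haar measure is positive on non-empty open sets, finite on compacta).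
-/

set_option autoImplicit false
-- the mandated namespace has the single-problem summit's repeated segment (`HodgeConjecture.HodgeConjecture`)
set_option linter.dupNamespace false

noncomputable section

open NumberField IsDedekindDomain MeasureTheory MeasureTheory.Measure Topology
open scoped Matrix MatrixGroups Pointwise
open Literature.NumberTheory.Automorphic Literature.NumberTheory.Automorphic.UnitaryGroup

namespace Summit.HodgeConjecture.HodgeConjecture.Cruxes.H413.F0P3cStCharTSConstants

/-! ## §1 Generic non-vanishing: Haar masses of compact opens, transversal cardinalities, the `hval` algebra -/

section Generic

variable {X : Type*} [TopologicalSpace X] [MeasurableSpace X]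

/-- A non-empty open set with compact closure-free bound — here: open, compact, non-empty — has POSITIVE real mass for every measure positive on opens and finite on compacta
(e.g. a Haar measure). [cite: HewittRoss1979, (15.8)] -/
theorem measureReal_pos_of_isOpen_of_isCompact (μ : Measure X) [μ.IsOpenPosMeasure] [IsFiniteMeasureOnCompacts μ]
    {U : Set X} (hUo : IsOpen U) (hUc : IsCompact U) (hne : U.Nonempty) : 0 < μ.real U :=
  ENNReal.toReal_pos (hUo.measure_ne_zero μ hne) hUc.measure_lt_top.ne

/-- The complex cast of the real mass of a non-empty compact open set is non-zero. [cite: HewittRoss1979, (15.8)] -/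
theorem ofReal_measureReal_ne_zero_of_isOpen_of_isCompact (μ : Measure X) [μ.IsOpenPosMeasure] [IsFiniteMeasureOnCompacts μ]
    {U : Set X} (hUo : IsOpen U) (hUc : IsCompact U) (hne : U.Nonempty) : ((μ.real U : ℝ) : ℂ) ≠ 0 :=
  Complex.ofReal_ne_zero.2 (measureReal_pos_of_isOpen_of_isCompact μ hUo hUc hne).ne'

/-- On a compact space the total real mass is positive (measure positive on opens, finite on compacta; the space non-empty). [cite: HewittRoss1979, (15.8)] -/
theorem measureReal_univ_pos_of_compactSpace [CompactSpace X] [Nonempty X] (μ : Measure X) [μ.IsOpenPosMeasure] [IsFiniteMeasureOnCompacts μ] :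
    0 < μ.real Set.univ :=
  measureReal_pos_of_isOpen_of_isCompact μ isOpen_univ isCompact_univ Set.univ_nonempty

/-- **Transport along a continuous surjection**: the push-forward `f_* μ` of a measure positive on opens and finite on compacta gives positive real mass to a non-empty open set
`U` whose preimage is compact (e.g. `f` a homeomorphism and `U` compact open). [cite: HewittRoss1979, (15.8)] -/
theorem measureReal_map_pos_of_isOpen {Y : Type*} [TopologicalSpace Y] [MeasurableSpace Y] [BorelSpace Y] [OpensMeasurableSpace X]
    (μ : Measure X) [μ.IsOpenPosMeasure] [IsFiniteMeasureOnCompacts μ] {f : X → Y} (hf : Continuous f) (hsurj : Function.Surjective f)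
    {U : Set Y} (hUo : IsOpen U) (hUc : IsCompact (f ⁻¹' U)) (hne : U.Nonempty) : 0 < (μ.map f).real U := by
  rw [measureReal_def, Measure.map_apply hf.measurable hUo.measurableSet]
  exact ENNReal.toReal_pos ((hUo.preimage hf).measure_ne_zero μ (hne.preimage hsurj)) hUc.measure_lt_top.ne

variable {G : Type*} [Group G] [TopologicalSpace G] [MeasurableSpace G]

/-- A compact open subgroup has positive real mass (it contains `1`). [cite: HewittRoss1979, (15.8)] -/
theorem measureReal_coe_subgroup_pos (μ : Measure G) [μ.IsOpenPosMeasure] [IsFiniteMeasureOnCompacts μ]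
    (K : Subgroup G) (hKo : IsOpen (K : Set G)) (hKc : IsCompact (K : Set G)) : 0 < μ.real (K : Set G) :=
  measureReal_pos_of_isOpen_of_isCompact μ hKo hKc ⟨1, K.one_mem⟩

/-- The complex cast of the real mass of a compact open subgroup is non-zero. [cite: HewittRoss1979, (15.8)] -/
theorem ofReal_measureReal_coe_subgroup_ne_zero (μ : Measure G) [μ.IsOpenPosMeasure] [IsFiniteMeasureOnCompacts μ]
    (K : Subgroup G) (hKo : IsOpen (K : Set G)) (hKc : IsCompact (K : Set G)) : ((μ.real (K : Set G) : ℝ) : ℂ) ≠ 0 :=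
  Complex.ofReal_ne_zero.2 (measureReal_coe_subgroup_pos μ K hKo hKc).ne'

/-- The levels `K n` of an Iwahori datum (compact open subgroups) have positive real mass. [cite: HewittRoss1979, (15.8)] -/
theorem measureReal_iwahoriK_pos (t : ParabolicTriple G) (𝓘 : t.IwahoriDatum) (μ : Measure G) [μ.IsOpenPosMeasure] [IsFiniteMeasureOnCompacts μ]
    (n : ℕ) : 0 < μ.real (𝓘.K n : Set G) :=
  measureReal_coe_subgroup_pos μ (𝓘.K n) (𝓘.isOpen_K n) (𝓘.isCompact_K n)

/-- The complex cast of the real mass of an Iwahori level `K n` is non-zero. [cite: HewittRoss1979, (15.8)] -/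
theorem ofReal_measureReal_iwahoriK_ne_zero (t : ParabolicTriple G) (𝓘 : t.IwahoriDatum) (μ : Measure G) [μ.IsOpenPosMeasure] [IsFiniteMeasureOnCompacts μ]
    (n : ℕ) : ((μ.real (𝓘.K n : Set G) : ℝ) : ℂ) ≠ 0 :=
  Complex.ofReal_ne_zero.2 (measureReal_iwahoriK_pos t 𝓘 μ n).ne'

omit [TopologicalSpace G] [MeasurableSpace G] in
/-- A finite left transversal is non-empty (★ `IsLeftTransversal.nonempty`), so its cardinality is a non-zero complex number. [folklore] -/
theorem natCast_card_ne_zero_of_isLeftTransversal {B S : Subgroup G} {R : Finset G} (hR : IsLeftTransversal B S R) : (R.card : ℂ) ≠ 0 :=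
  Nat.cast_ne_zero.2 (Finset.card_pos.2 hR.nonempty).ne'

/-- **The `hval` slot by the choice `c_j := τ_j · c ∕ κ_{H,j}`** (`c = κ_G κ` for ★ `hc_of_cosetSum`): `c_j · κ_{H,j} = τ_j · c` as soon as `κ_{H,j} ≠ 0`.
[cite: Rogawski1990, §12.7 L. 12.7.3 (proof) p. 195] -/
theorem hval_of_div {ι : Type*} (s : Finset ι) (τ κH : ι → ℂ) (c : ℂ) (hH : ∀ j ∈ s, κH j ≠ 0) :
    ∀ j ∈ s, τ j * c / κH j * κH j = τ j * c :=
  fun j hj => div_mul_cancel₀ _ (hH j hj)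

/-- The `hval` slot, `fun`-packaged: with `cj := fun j => τ j * c / κH j`, `∀ j ∈ s, cj j * κH j = τ j * c`. [cite: Rogawski1990, §12.7 L. 12.7.3 (proof) p. 195] -/
theorem hval_of_div' {ι : Type*} (s : Finset ι) (τ κH : ι → ℂ) (c : ℂ) (hH : ∀ j ∈ s, κH j ≠ 0) :
    ∀ j ∈ s, (fun j => τ j * c / κH j) j * κH j = τ j * c :=
  hval_of_div s τ κH c hH

end Generic

/-! ## §2 The CM torus level: `0 < μ_T(T ∩ K_v)` at every rank `N` -/

section TorusLevel

variable (L : Type) [Field L] [NumberField L] [IsCMField L]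

/-- **`0 < μ_T{t ∈ T_N | t ∈ K_v}`** at every rank `N` (★ `measureReal_cmBorelM_inter_level_pos` is the case `N = 3`; same proof): `K_v = U(Φ_N)(𝒪_v)` is compact open
(★ `isCompact_isOpen_cmLocalIntegralLevel`), the torus is closed (★ `isClosed_torusU_of_t1Space`), so the slice is a compact open subset of `T_N` containing `1`.
[cite: HewittRoss1979, (15.8)] -/
theorem measureReal_cmBorelM_inter_level_pos' (N : ℕ) (v : HeightOneSpectrum (𝓞 ↥(maximalRealSubfield L)))
    [MeasurableSpace ↥(unitaryGroupOfForm (conjLocal L (IsCMField.complexConj L) v) (cmLocalForm L N v))]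
    [BorelSpace ↥(unitaryGroupOfForm (conjLocal L (IsCMField.complexConj L) v) (cmLocalForm L N v))]
    (μT : Measure ↥(cmBorelTriple L N v).M) [μT.IsHaarMeasure] :
    0 < μT.real {t : ↥(cmBorelTriple L N v).M |
          (t : ↥(unitaryGroupOfForm (conjLocal L (IsCMField.complexConj L) v) (cmLocalForm L N v))) ∈
            cmLocalIntegralLevel L N (Matrix.of fun i j : Fin N => if i.val + j.val + 1 = N then (1 : L) else 0) v} := by
  haveI := locallyCompactSpace_cmBorelU L N v
  haveI : T1Space (LocalRing L v) := inferInstance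
  have hKco := isCompact_isOpen_cmLocalIntegralLevel L N (Matrix.of fun i j : Fin N => if i.val + j.val + 1 = N then (1 : L) else 0) v
  have hTcl := isClosed_torusU_of_t1Space (conjLocal L (IsCMField.complexConj L) v) (cmLocalForm L N v)
  have hop : IsOpen {t : ↥(cmBorelTriple L N v).M |
          (t : ↥(unitaryGroupOfForm (conjLocal L (IsCMField.complexConj L) v) (cmLocalForm L N v))) ∈
            cmLocalIntegralLevel L N (Matrix.of fun i j : Fin N => if i.val + j.val + 1 = N then (1 : L) else 0) v} := hKco.2.preimage continuous_subtype_val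
  have hcp : IsCompact {t : ↥(cmBorelTriple L N v).M |
          (t : ↥(unitaryGroupOfForm (conjLocal L (IsCMField.complexConj L) v) (cmLocalForm L N v))) ∈
            cmLocalIntegralLevel L N (Matrix.of fun i j : Fin N => if i.val + j.val + 1 = N then (1 : L) else 0) v} :=
    hTcl.isClosedEmbedding_subtypeVal.isCompact_preimage hKco.1
  exact measureReal_pos_of_isOpen_of_isCompact μT hop hcp ⟨1, by
    show ((1 : ↥(cmBorelTriple L N v).M) : ↥(unitaryGroupOfForm (conjLocal L (IsCMField.complexConj L) v) (cmLocalForm L N v))) ∈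
      cmLocalIntegralLevel L N (Matrix.of fun i j : Fin N => if i.val + j.val + 1 = N then (1 : L) else 0) v
    rw [OneMemClass.coe_one]; exact Subgroup.one_mem _⟩

end TorusLevel

/-! ## §3 `κ_G ≠ 0`: the constant of ★ D3-ii-G at `A := ν(K_n)·#R·δ_B^{1∕2}(b)` (F1-G ∕ HF1-SHELL) -/

section G

variable (L : Type) [Field L] [NumberField L] [IsCMField L]

set_option maxHeartbeats 4000000 in  -- cross-spelling `whnf` `(cmDatum L N Φ_N).Local v` ≡ `↥(unitaryGroupOfForm … (cmLocalForm L N v))` (measured class, as ★ F1-H)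
set_option synthInstance.maxHeartbeats 400000 in  -- instance synthesis on the CM carriers `(cmDatum L N Φ_N).Local v` (measured class, as ★ F1-H ∕ ★ D3-ii-H)
/-- **`κ_G ≠ 0`.**  For the frame congruence `e = cmDatumLocalCongr L v T ha h : U(Φ₃)_v ≃ₜ* U(H)_v`, a Haar measure `ν_G` on `U(H)_v`, a Haar measure `μ_T` on `T₃`, an Iwahori datum `𝓘`,
a level `n`, a torus point `b`, a finite left transversal `R` of `K_n ∕ (K_n ∩ bK_nb⁻¹)` and a compact open `C ≤ T₃`:
`κ_G := (ν_G∘e⁻¹)(K_n) · #R · δ_B^{1∕2}(b) · μ_T{T ∩ K_v} ∕ μ_T(C) ≠ 0` — the scalar of the two-coset step function in ★ `classOrbitalIntegral_mk_eq_twoCoset` with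
`A := (ν_G∘e⁻¹)(K_n) · #R · δ_B^{1∕2}(b)` (★ F1-G `smoothTrace_cmPrincipalSeries_indicator_shell_eq_ite` ∕ HF1-SHELL), tokens as printed there.
[cite: Rogawski1990, §4.9 (4.9.4) p. 56; §12.7 L. 12.7.3 (proof) p. 195] -/
theorem kappaG_ne_zero (H : Matrix (Fin 3) (Fin 3) L) {v : HeightOneSpectrum (𝓞 ↥(maximalRealSubfield L))}
    (T : GL (Fin 3) (LocalRing L v)) {a : LocalRing L v} (ha : IsUnit a)
    (h : formCongr (conjLocal L (IsCMField.complexConj L) v) T (H.map (algebraMap L (LocalRing L v))) =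
      a • (Matrix.of fun i j : Fin 3 => if i.val + j.val + 1 = 3 then (1 : L) else 0).map (algebraMap L (LocalRing L v)))
    [MeasurableSpace ((cmDatum L 3 H).Local v)] [BorelSpace ((cmDatum L 3 H).Local v)]
    (νG : Measure ((cmDatum L 3 H).Local v)) [νG.IsHaarMeasure]
    [MeasurableSpace ↥(unitaryGroupOfForm (conjLocal L (IsCMField.complexConj L) v) (cmLocalForm L 3 v))]
    [BorelSpace ↥(unitaryGroupOfForm (conjLocal L (IsCMField.complexConj L) v) (cmLocalForm L 3 v))]
    (μT : Measure ↥(cmBorelTriple L 3 v).M) [μT.IsHaarMeasure]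
    (𝓘 : (cmBorelTriple L 3 v).IwahoriDatum) (n : ℕ)
    {b : ↥(unitaryGroupOfForm (conjLocal L (IsCMField.complexConj L) v) (cmLocalForm L 3 v))} (hbM : b ∈ (cmBorelTriple L 3 v).M)
    {R : Finset ↥(unitaryGroupOfForm (conjLocal L (IsCMField.complexConj L) v) (cmLocalForm L 3 v))}
    (hR : IsLeftTransversal (𝓘.K n) (𝓘.K n ⊓ ConjAct.toConjAct b • 𝓘.K n) R)
    (C : Subgroup ↥(cmBorelTriple L 3 v).M) (hCo : IsOpen (C : Set ↥(cmBorelTriple L 3 v).M)) (hCc : IsCompact (C : Set ↥(cmBorelTriple L 3 v).M)) :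
    haveI := locallyCompactSpace_cmBorelU L 3 v
    (((νG.map (cmDatumLocalCongr L v T ha h).symm :
        Measure ↥(unitaryGroupOfForm (conjLocal L (IsCMField.complexConj L) v) (cmLocalForm L 3 v))).real
          (𝓘.K n : Set ↥(unitaryGroupOfForm (conjLocal L (IsCMField.complexConj L) v) (cmLocalForm L 3 v))) : ℝ) : ℂ) *
          (R.card : ℂ) *
          ((rootDeltaChar (cmBorelTriple L 3 v).P (Subgroup.inclusion (cmBorelTriple L 3 v).M_le ⟨b, hbM⟩) : ℂˣ) : ℂ) *
        ((μT.real {t : ↥(cmBorelTriple L 3 v).M |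
          (t : ↥(unitaryGroupOfForm (conjLocal L (IsCMField.complexConj L) v) (cmLocalForm L 3 v))) ∈
            cmLocalIntegralLevel L 3 (Matrix.of fun i j : Fin 3 => if i.val + j.val + 1 = 3 then (1 : L) else 0) v} : ℝ) : ℂ) /
      ((μT.real (C : Set ↥(cmBorelTriple L 3 v).M) : ℝ) : ℂ) ≠ 0 := by
  haveI := locallyCompactSpace_cmBorelU L 3 v
  -- `(ν_G ∘ e⁻¹)(K_n) > 0`: transport along the homeomorphism `e⁻¹ = (cmDatumLocalCongr …).symm`
  -- continuity ∕ compact preimage of `e⁻¹` READ IN THE `unitaryGroupOfForm` SPELLING of its target (the spelling of `𝓘`, `cmBorelTriple` and of the σ-algebra binder)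
  have hcont : @Continuous ((cmDatum L 3 H).Local v) ↥(unitaryGroupOfForm (conjLocal L (IsCMField.complexConj L) v) (cmLocalForm L 3 v)) _ _
      (fun x : (cmDatum L 3 H).Local v => (cmDatumLocalCongr L v T ha h).symm x) :=
    (cmDatumLocalCongr L v T ha h).symm.continuous
  have hcpt : IsCompact ((fun x : (cmDatum L 3 H).Local v => (cmDatumLocalCongr L v T ha h).symm x) ⁻¹'
        (𝓘.K n : Set ↥(unitaryGroupOfForm (conjLocal L (IsCMField.complexConj L) v) (cmLocalForm L 3 v)))) :=
    (cmDatumLocalCongr L v T ha h).symm.toHomeomorph.isCompact_preimage.2 (𝓘.isCompact_K n)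
  have hK : 0 < (νG.map (cmDatumLocalCongr L v T ha h).symm :
      Measure ↥(unitaryGroupOfForm (conjLocal L (IsCMField.complexConj L) v) (cmLocalForm L 3 v))).real
        (𝓘.K n : Set ↥(unitaryGroupOfForm (conjLocal L (IsCMField.complexConj L) v) (cmLocalForm L 3 v))) :=
    measureReal_map_pos_of_isOpen νG hcont (cmDatumLocalCongr L v T ha h).symm.surjective (𝓘.isOpen_K n) hcpt ⟨1, Subgroup.one_mem _⟩
  refine div_ne_zero (mul_ne_zero (mul_ne_zero (mul_ne_zero (Complex.ofReal_ne_zero.2 hK.ne') (natCast_card_ne_zero_of_isLeftTransversal hR))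
    (Units.ne_zero _)) ?_) (ofReal_measureReal_coe_subgroup_ne_zero μT C hCo hCc)
  exact Complex.ofReal_ne_zero.2 (measureReal_cmBorelM_inter_level_pos' L 3 v μT).ne'

set_option synthInstance.maxHeartbeats 400000 in  -- instance synthesis on the CM carriers `(cmDatum L N Φ_N).Local v` (measured class, as ★ F1-H ∕ ★ D3-ii-H)
/-- **`κ_G · κ ≠ 0`** for a non-zero two-coset weight `κ` (e.g. `κ = 1` in HF1-SHELL): the product fed to ★ `hc_of_cosetSum`'s `hval`. [cite: Rogawski1990, §4.9 (4.9.4) p. 56] -/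
theorem kappaG_mul_ne_zero (H : Matrix (Fin 3) (Fin 3) L) {v : HeightOneSpectrum (𝓞 ↥(maximalRealSubfield L))}
    (T : GL (Fin 3) (LocalRing L v)) {a : LocalRing L v} (ha : IsUnit a)
    (h : formCongr (conjLocal L (IsCMField.complexConj L) v) T (H.map (algebraMap L (LocalRing L v))) =
      a • (Matrix.of fun i j : Fin 3 => if i.val + j.val + 1 = 3 then (1 : L) else 0).map (algebraMap L (LocalRing L v)))
    [MeasurableSpace ((cmDatum L 3 H).Local v)] [BorelSpace ((cmDatum L 3 H).Local v)]
    (νG : Measure ((cmDatum L 3 H).Local v)) [νG.IsHaarMeasure]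
    [MeasurableSpace ↥(unitaryGroupOfForm (conjLocal L (IsCMField.complexConj L) v) (cmLocalForm L 3 v))]
    [BorelSpace ↥(unitaryGroupOfForm (conjLocal L (IsCMField.complexConj L) v) (cmLocalForm L 3 v))]
    (μT : Measure ↥(cmBorelTriple L 3 v).M) [μT.IsHaarMeasure]
    (𝓘 : (cmBorelTriple L 3 v).IwahoriDatum) (n : ℕ)
    {b : ↥(unitaryGroupOfForm (conjLocal L (IsCMField.complexConj L) v) (cmLocalForm L 3 v))} (hbM : b ∈ (cmBorelTriple L 3 v).M)
    {R : Finset ↥(unitaryGroupOfForm (conjLocal L (IsCMField.complexConj L) v) (cmLocalForm L 3 v))}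
    (hR : IsLeftTransversal (𝓘.K n) (𝓘.K n ⊓ ConjAct.toConjAct b • 𝓘.K n) R)
    (C : Subgroup ↥(cmBorelTriple L 3 v).M) (hCo : IsOpen (C : Set ↥(cmBorelTriple L 3 v).M)) (hCc : IsCompact (C : Set ↥(cmBorelTriple L 3 v).M))
    {κ : ℂ} (hκ : κ ≠ 0) :
    haveI := locallyCompactSpace_cmBorelU L 3 v
    (((νG.map (cmDatumLocalCongr L v T ha h).symm :
        Measure ↥(unitaryGroupOfForm (conjLocal L (IsCMField.complexConj L) v) (cmLocalForm L 3 v))).real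
          (𝓘.K n : Set ↥(unitaryGroupOfForm (conjLocal L (IsCMField.complexConj L) v) (cmLocalForm L 3 v))) : ℝ) : ℂ) *
          (R.card : ℂ) *
          ((rootDeltaChar (cmBorelTriple L 3 v).P (Subgroup.inclusion (cmBorelTriple L 3 v).M_le ⟨b, hbM⟩) : ℂˣ) : ℂ) *
        ((μT.real {t : ↥(cmBorelTriple L 3 v).M |
          (t : ↥(unitaryGroupOfForm (conjLocal L (IsCMField.complexConj L) v) (cmLocalForm L 3 v))) ∈
            cmLocalIntegralLevel L 3 (Matrix.of fun i j : Fin 3 => if i.val + j.val + 1 = 3 then (1 : L) else 0) v} : ℝ) : ℂ) /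
      ((μT.real (C : Set ↥(cmBorelTriple L 3 v).M) : ℝ) : ℂ) * κ ≠ 0 :=
  mul_ne_zero (kappaG_ne_zero L H T ha h νG μT 𝓘 n hbM hR C hCo hCc) hκ

end G

/-! ## §4 `κ_{H,j} ≠ 0`: the constant of ★ D3-ii-H at `A := ν₂(K_{2,n′})·#R₂·ν₁(K₁)·δ_{B₂}^{1∕2}(u)` (F1-H ∕ hF1H-ADAPTER) times `χ₁(z₁)` -/

section H1

variable (L : Type) [Field L] [NumberField L] [IsCMField L] (v : HeightOneSpectrum (𝓞 ↥(maximalRealSubfield L)))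
  [MeasurableSpace ((cmDatum L 1 (Matrix.of fun i j : Fin 1 => if i.val + j.val + 1 = 1 then (1 : L) else 0)).Local v)]

set_option synthInstance.maxHeartbeats 400000 in  -- instance synthesis on the CM carriers `(cmDatum L N Φ_N).Local v` (measured class, as ★ F1-H ∕ ★ D3-ii-H)
/-- **`ν₁(U(Φ₁)_v) > 0`** as a real number: `U(Φ₁)_v` is covered by its (compact open) integral level `K_{1,v}` (hypothesis `hK₁`, as in ★ D3-ii-H), hence compact; Haar
mass of a non-empty compact open set. [cite: HewittRoss1979, (15.8)] -/
theorem measureReal_univ_unitaryOne_pos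
    (ν₁ : Measure ((cmDatum L 1 (Matrix.of fun i j : Fin 1 => if i.val + j.val + 1 = 1 then (1 : L) else 0)).Local v)) [ν₁.IsHaarMeasure]
    (hK₁ : ∀ x : ((cmDatum L 1 (Matrix.of fun i j : Fin 1 => if i.val + j.val + 1 = 1 then (1 : L) else 0)).Local v),
      x ∈ cmLocalIntegralLevel L 1 (Matrix.of fun i j : Fin 1 => if i.val + j.val + 1 = 1 then (1 : L) else 0) v) :
    0 < ν₁.real Set.univ := by
  have hKco := isCompact_isOpen_cmLocalIntegralLevel L 1 (Matrix.of fun i j : Fin 1 => if i.val + j.val + 1 = 1 then (1 : L) else 0) v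
  have huniv : (Set.univ : Set ((cmDatum L 1 (Matrix.of fun i j : Fin 1 => if i.val + j.val + 1 = 1 then (1 : L) else 0)).Local v)) =
      (cmLocalIntegralLevel L 1 (Matrix.of fun i j : Fin 1 => if i.val + j.val + 1 = 1 then (1 : L) else 0) v :
        Set ((cmDatum L 1 (Matrix.of fun i j : Fin 1 => if i.val + j.val + 1 = 1 then (1 : L) else 0)).Local v)) :=
    Set.eq_of_subset_of_subset (fun x _ => hK₁ x) (Set.subset_univ _)
  rw [huniv]
  exact measureReal_pos_of_isOpen_of_isCompact ν₁ hKco.2 hKco.1 ⟨1, Subgroup.one_mem _⟩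

end H1

section H

variable (L : Type) [Field L] [NumberField L] [IsCMField L] (v : HeightOneSpectrum (𝓞 ↥(maximalRealSubfield L)))
  [MeasurableSpace ((cmDatum L 2 (Matrix.of fun i j : Fin 2 => if i.val + j.val + 1 = 2 then (1 : L) else 0)).Local v)]
  [MeasurableSpace ((cmDatum L 1 (Matrix.of fun i j : Fin 1 => if i.val + j.val + 1 = 1 then (1 : L) else 0)).Local v)]

set_option maxHeartbeats 4000000 in  -- cross-spelling `whnf` `(cmDatum L N Φ_N).Local v` ≡ `↥(unitaryGroupOfForm … (cmLocalForm L N v))` (measured class, as ★ F1-H)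
set_option synthInstance.maxHeartbeats 400000 in  -- instance synthesis on the CM carriers `(cmDatum L N Φ_N).Local v` (measured class, as ★ F1-H ∕ ★ D3-ii-H)
/-- **`κ_{H,j} ≠ 0`.**  For Haar measures `ν₂` on `U(Φ₂)_v`, `ν₁` on `U(Φ₁)_v` (covered by `K_{1,v}`: `hK₁`), `μ_T` on `T₂`; an Iwahori datum `𝓘₂`, a level `n`, a torus point `u`
(the `H`-dominant representative `u_{j,2}` of the `j`-th coset), a finite left transversal `R₂`, a compact open `K₁ ≤ U(Φ₁)_v`, a character `χ₁` of `U(Φ₁)_v`, a point `z₁`,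
and a compact open `C₂ ≤ T₂`:
`κ_{H,j} := (ν₂(K_{2,n}) · #R₂ · ν₁(K₁) · δ_{B₂}^{1∕2}(u)) · χ₁(z₁) · (μ_T{T₂ ∩ K_{2,v}} · ν₁(univ)) ∕ (μ_T(C₂) · ν₁(K₁)) ≠ 0` — the scalar of the two-coset step function in ★
`classOrbitalIntegralH_eq_twoCoset_apply` with `A :=` the hF1H-ADAPTER constant (★ F1-H `smoothTrace_cmPrincipalSeriesH_indicator_shell_eq_ite` re-bracketed by LH7-p04 (g2)'s
`smoothTrace_cmPrincipalSeriesH_indicator_shell_eq_hF1H`), tokens as printed there. [cite: Rogawski1990, §4.9 (4.9.4) p. 56; §12.7 L. 12.7.3 (proof) p. 195] -/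
theorem kappaH_ne_zero
    (ν₂ : Measure ((cmDatum L 2 (Matrix.of fun i j : Fin 2 => if i.val + j.val + 1 = 2 then (1 : L) else 0)).Local v)) [ν₂.IsHaarMeasure]
    (ν₁ : Measure ((cmDatum L 1 (Matrix.of fun i j : Fin 1 => if i.val + j.val + 1 = 1 then (1 : L) else 0)).Local v)) [ν₁.IsHaarMeasure]
    (hK₁ : ∀ x : ((cmDatum L 1 (Matrix.of fun i j : Fin 1 => if i.val + j.val + 1 = 1 then (1 : L) else 0)).Local v),
      x ∈ cmLocalIntegralLevel L 1 (Matrix.of fun i j : Fin 1 => if i.val + j.val + 1 = 1 then (1 : L) else 0) v)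
    [MeasurableSpace ↥(unitaryGroupOfForm (conjLocal L (IsCMField.complexConj L) v) (cmLocalForm L 2 v))]
    [BorelSpace ↥(unitaryGroupOfForm (conjLocal L (IsCMField.complexConj L) v) (cmLocalForm L 2 v))]
    (μT : Measure ↥(cmBorelTriple L 2 v).M) [μT.IsHaarMeasure]
    (𝓘₂ : (cmBorelTriple L 2 v).IwahoriDatum) (n : ℕ)
    {u : ↥(unitaryGroupOfForm (conjLocal L (IsCMField.complexConj L) v) (cmLocalForm L 2 v))} (huM : u ∈ (cmBorelTriple L 2 v).M)
    {R₂ : Finset ↥(unitaryGroupOfForm (conjLocal L (IsCMField.complexConj L) v) (cmLocalForm L 2 v))}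
    (hR₂ : IsLeftTransversal (𝓘₂.K n) (𝓘₂.K n ⊓ ConjAct.toConjAct u • 𝓘₂.K n) R₂)
    (K₁ : Subgroup ((cmDatum L 1 (Matrix.of fun i j : Fin 1 => if i.val + j.val + 1 = 1 then (1 : L) else 0)).Local v))
    (hK₁o : IsOpen (K₁ : Set ((cmDatum L 1 (Matrix.of fun i j : Fin 1 => if i.val + j.val + 1 = 1 then (1 : L) else 0)).Local v)))
    (hK₁c : IsCompact (K₁ : Set ((cmDatum L 1 (Matrix.of fun i j : Fin 1 => if i.val + j.val + 1 = 1 then (1 : L) else 0)).Local v)))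
    (χ₁ : ((cmDatum L 1 (Matrix.of fun i j : Fin 1 => if i.val + j.val + 1 = 1 then (1 : L) else 0)).Local v) →* ℂˣ)
    (z₁ : ((cmDatum L 1 (Matrix.of fun i j : Fin 1 => if i.val + j.val + 1 = 1 then (1 : L) else 0)).Local v))
    (C₂ : Subgroup ↥(cmBorelTriple L 2 v).M) (hC₂o : IsOpen (C₂ : Set ↥(cmBorelTriple L 2 v).M)) (hC₂c : IsCompact (C₂ : Set ↥(cmBorelTriple L 2 v).M)) :
    haveI := locallyCompactSpace_cmBorelU L 2 v
    ((ν₂.real (𝓘₂.K n : Set ↥(unitaryGroupOfForm (conjLocal L (IsCMField.complexConj L) v) (cmLocalForm L 2 v))) : ℂ) * (R₂.card : ℂ) *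
            (ν₁.real (K₁ : Set ((cmDatum L 1 (Matrix.of fun i j : Fin 1 => if i.val + j.val + 1 = 1 then (1 : L) else 0)).Local v)) : ℂ) *
            ((rootDeltaChar (cmBorelTriple L 2 v).P (Subgroup.inclusion (cmBorelTriple L 2 v).M_le ⟨u, huM⟩) : ℂˣ) : ℂ)) *
          ((χ₁ z₁ : ℂˣ) : ℂ) *
        ((μT.real {t : ↥(cmBorelTriple L 2 v).M |
            (t : ↥(unitaryGroupOfForm (conjLocal L (IsCMField.complexConj L) v) (cmLocalForm L 2 v))) ∈
              cmLocalIntegralLevel L 2 (Matrix.of fun i j : Fin 2 => if i.val + j.val + 1 = 2 then (1 : L) else 0) v} * ν₁.real Set.univ : ℝ) : ℂ) /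
      ((μT.real (C₂ : Set ↥(cmBorelTriple L 2 v).M) *
          ν₁.real (K₁ : Set ((cmDatum L 1 (Matrix.of fun i j : Fin 1 => if i.val + j.val + 1 = 1 then (1 : L) else 0)).Local v)) : ℝ) : ℂ) ≠ 0 := by
  haveI := locallyCompactSpace_cmBorelU L 2 v
  have hK₁pos : 0 < ν₁.real (K₁ : Set ((cmDatum L 1 (Matrix.of fun i j : Fin 1 => if i.val + j.val + 1 = 1 then (1 : L) else 0)).Local v)) :=
    measureReal_coe_subgroup_pos ν₁ K₁ hK₁o hK₁c
  refine div_ne_zero (mul_ne_zero (mul_ne_zero ?_ (Units.ne_zero _)) ?_) ?_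
  · refine mul_ne_zero (mul_ne_zero (mul_ne_zero ?_ (natCast_card_ne_zero_of_isLeftTransversal hR₂)) (Complex.ofReal_ne_zero.2 hK₁pos.ne')) (Units.ne_zero _)
    -- `ν₂(K_{2,n}) > 0` on `ν₂`'s own carrier `(cmDatum L 2 Φ₂).Local v`: the level `K_{2,n}` is compact open THERE (same topology, definitionally)
    have hKo : @IsOpen ((cmDatum L 2 (Matrix.of fun i j : Fin 2 => if i.val + j.val + 1 = 2 then (1 : L) else 0)).Local v) _
        (𝓘₂.K n : Set ↥(unitaryGroupOfForm (conjLocal L (IsCMField.complexConj L) v) (cmLocalForm L 2 v))) := 𝓘₂.isOpen_K n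
    have hKc : @IsCompact ((cmDatum L 2 (Matrix.of fun i j : Fin 2 => if i.val + j.val + 1 = 2 then (1 : L) else 0)).Local v) _
        (𝓘₂.K n : Set ↥(unitaryGroupOfForm (conjLocal L (IsCMField.complexConj L) v) (cmLocalForm L 2 v))) := 𝓘₂.isCompact_K n
    exact Complex.ofReal_ne_zero.2 (measureReal_pos_of_isOpen_of_isCompact ν₂ hKo hKc ⟨_, (𝓘₂.K n).one_mem⟩).ne'
  · exact Complex.ofReal_ne_zero.2 (mul_pos (measureReal_cmBorelM_inter_level_pos' L 2 v μT) (measureReal_univ_unitaryOne_pos L v ν₁ hK₁)).ne'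
  · exact Complex.ofReal_ne_zero.2 (mul_pos (measureReal_coe_subgroup_pos μT C₂ hC₂o hC₂c) hK₁pos).ne'

/-- **The per-coset `hval` from `κ_{H,j} ≠ 0`** (★ KIT-B `hc_of_cosetSum` ∕ ★ p849876's slot): for any family `κH : ι → ℂ` of `H`-constants all non-zero on `s` (e.g. each
`κH j` an instance of `kappaH_ne_zero` at the `j`-th representative), the choice `cj j := τ j * (κG * κ) / κH j` gives `∀ j ∈ s, cj j * κH j = τ j * (κG * κ)`.
[cite: Rogawski1990, §12.7 L. 12.7.3 (proof) p. 195] -/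
theorem hval_cosetSum {ι : Type*} (s : Finset ι) (τ κH : ι → ℂ) (κG κ : ℂ) (hH : ∀ j ∈ s, κH j ≠ 0) :
    ∀ j ∈ s, (fun j => τ j * (κG * κ) / κH j) j * κH j = τ j * (κG * κ) :=
  hval_of_div' s τ κH (κG * κ) hH

end H

end Summit.HodgeConjecture.HodgeConjecture.Cruxes.H413.F0P3cStCharTSConstants

end
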